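import Literature.AlgebraicGeometry.HodgeTheory.AbelianVarietyIntegralCohomology
import Literature.AlgebraicGeometry.HodgeTheory.IntegralClassesCountable
import Literature.AlgebraicTopology.SingularHomology.TorusCohomologyRingChange
import Literature.AlgebraicTopology.SingularHomology.CohomologyRingChangeFunctoriality
import Literature.AlgebraicTopology.SingularHomology.IntegralClassRingChange
import HarnessLib

/-!
# The integral lattice `Hᵏ(A(ℂ); ℤ) ⊂ Hᵏ(A(ℂ); F)`: `Hᵏ(A(ℂ); F) = Hᵏ(A(ℂ); ℤ) ⊗ F`

Layer A1/A4 of the Hodge foundations lane (`lit-hodgefound`), SKELETON.md rows A1-06 / A4-22 on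
the ALGEBRAIC carrier: the comparison between integral and field-valued singular cohomology of a
complex abelian variety. Lange, *Abelian Varieties over the Complex Numbers* (2023), §1.1.3
(PDF p. 23): "The universal coefficient theorem yields `H²(X, ℂ) = H²(X, ℤ) ⊗ ℂ`"; Voisin,
*Hodge Theory I*, §7.1.1: "`Hᵏ(X, ℤ) ⊗ R ≅ Hᵏ(X, R)`" (no torsion); Hatcher, *Algebraic Topology*,
§3.1 p. 198 (change of coefficients) and Example 3.16 (the cup-monomial bases of a torus over any
ring).

For `A : Motives.AbelianVariety ℂ` (`g = A.dim`), every `k` and every field `F` (of characteristic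
`0` where injectivity is concerned), with `ι = singularCohomology.ringChange (Int.castRingHom F)` the
change-of-coefficients map `Hᵏ(A(ℂ); ℤ) → Hᵏ(A(ℂ); F)` of the tree
(`SingularHomology/CohomologyRingChange`). ALL PROVED, no definition, no named fact (D-0026: net
Literature debt 0):

* `AbelianVariety.exists_basis_ringChange_int_eq` — **compatible bases**: a `ℤ`-basis `b_ℤ` of
  `Hᵏ(A(ℂ); ℤ)` and an `F`-basis `b_F` of `Hᵏ(A(ℂ); F)`, both indexed by the `k`-subsets of
  `Fin 2g`, with `ι (b_ℤ s) = b_F s` (the cup-monomial bases of the torus `(ℝ/ℤ)^{2g} ≃ₜ A(ℂ)` over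
  `ℤ` and over `F`, `torusMonomialBasisInt'` / `torusMonomialBasis`, correspond under `ι`,
  `ringChange_torusMonomial`, and `ι` is natural, `singularCohomology.ringChange_map`);
* `AbelianVariety.ringChange_int_apply_eq_sum` — `ι x = Σ_s (b_ℤ.repr x s : F) • b_F s`;
* `AbelianVariety.ringChange_int_injective` — **`Hᵏ(A(ℂ); ℤ) ↪ Hᵏ(A(ℂ); F)`** (`char F = 0`);
* `AbelianVariety.span_range_ringChange_int_eq_top` — **the integral classes span `Hᵏ(A(ℂ); F)`
  over `F`** — together: `Hᵏ(A(ℂ); F) = Hᵏ(A(ℂ); ℤ) ⊗_ℤ F` with `Hᵏ(A(ℂ); ℤ)` a full lattice;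
* `AbelianVariety.exists_basis_isIntegralClass`, `AbelianVariety.span_setOf_isIntegralClass_eq_top` —
  for `F = ℂ` in the language of the Hodge-theory files (`IsIntegralClass`,
  `isIntegralClass_iff_mem_range_ringChange`): `Hᵏ(A(ℂ); ℂ)` has a `ℂ`-basis consisting of integral
  classes, and the integral classes span;
* `AbelianVariety.nonempty_range_ringChange_int_addEquiv` — the lattice of integral classes
  `ι(Hᵏ(A(ℂ); ℤ)) ⊂ Hᵏ(A(ℂ); F)` is `≃+ Hᵏ(A(ℂ); ℤ)` (free of rank `C(2g, k)`,
  `AbelianVariety.finrank_singularCohomology_int`).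

## References

* H. Lange, *Abelian Varieties over the Complex Numbers*, Grundlehren Text Editions (2023), §1.1.3
  (PDF p. 23). [Lange2023AbelianVarietiesComplex]
* C. Voisin, *Hodge Theory and Complex Algebraic Geometry I* (2002), §7.1.1. [VoisinHodgeI2002]
* A. Hatcher, *Algebraic Topology* (2002), §3.1 p. 198, §3.2 Example 3.16. [HatcherAT2002]
-/

noncomputable section

open Function Module CategoryTheory
open Literature.AlgebraicTopology.SingularHomology
open Literature.AlgebraicGeometry.Motives
open Literature.Geometry.Kaehler

namespace Literature.AlgebraicGeometry.HodgeTheory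

namespace AbelianVariety

variable (A : AbelianVariety ℂ) (F : Type) [Field F]

/-- `A(ℂ)` is homeomorphic to the standard torus `(ℝ/ℤ)^{2g}` (`Torus m`, `m = 2 dim A`): the
uniformisation `ℂ^g/Λ ≃ₜ A(ℂ)` (`exists_homeomorph_complexTorus`) composed with the real-coordinate
homeomorphism `ℂ^g/Λ ≃ₜ (ℝ/ℤ)^{2g}` of a complex torus (`ComplexTorus.toTorus`).
[cite: Lange2023AbelianVarietiesComplex, §1.1.3 (PDF p. 23)] -/
theorem exists_homeomorph_torus :
    ∃ m : ℕ, m = 2 * A.dim ∧ Nonempty (Torus m ≃ₜ ComplexPoints A.X) := by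
  obtain ⟨ι, _, Φ, ⟨e⟩⟩ := exists_homeomorph_complexTorus A
  exact ⟨Fintype.card ι, card_eq_two_mul_dim A Φ, ⟨(ComplexTorus.toTorus Φ).symm.trans e⟩⟩

/-- **Compatible bases of `Hᵏ(A(ℂ); ℤ)` and `Hᵏ(A(ℂ); F)`**: there are a `ℤ`-basis `b_ℤ` of
`Hᵏ(A(ℂ); ℤ)` and an `F`-basis `b_F` of `Hᵏ(A(ℂ); F)`, both indexed by the `k`-subsets of `Fin 2g`,
such that the change of coefficients `ℤ → F` maps `b_ℤ s` to `b_F s` — the transported cup-monomial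
bases of the torus `(ℝ/ℤ)^{2g}` (Hatcher Example 3.16 over `ℤ` and over `F`), which correspond
under the change of rings (`ringChange_torusMonomial`) naturally in the homeomorphism
(`singularCohomology.ringChange_map`). This is "`Hᵏ(X, F) = Hᵏ(X, ℤ) ⊗ F`" for `X = A(ℂ)`.
[cite: Lange2023AbelianVarietiesComplex, §1.1.3 (PDF p. 23)] [cite: VoisinHodgeI2002, §7.1.1]
[cite: HatcherAT2002, §3.2 Example 3.16] -/
theorem exists_basis_ringChange_int_eq (k : ℕ) :
    ∃ (bZ : Module.Basis (Set.powersetCard (Fin (2 * A.dim)) k) ℤ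
        (singularCohomology ℤ ℤ (ComplexPoints A.X) k))
      (bF : Module.Basis (Set.powersetCard (Fin (2 * A.dim)) k) F
        (singularCohomology F F (ComplexPoints A.X) k)),
      ∀ s, singularCohomology.ringChange (Int.castRingHom F) (ComplexPoints A.X) k (bZ s) = bF s := by
  obtain ⟨m, hm, ⟨h⟩⟩ := exists_homeomorph_torus A
  rw [← hm]
  -- pull-back along `h⁻¹ : A(ℂ) → (ℝ/ℤ)^m`, an isomorphism `Hᵏ((ℝ/ℤ)^m) ≅ Hᵏ(A(ℂ))` over `ℤ` and `F`
  let eZ : singularCohomology ℤ ℤ (Torus m) k ≃ₗ[ℤ] singularCohomology ℤ ℤ (ComplexPoints A.X) k :=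
    (singularCohomology.mapIso ℤ ℤ h.symm k).toLinearEquiv
  let eF : singularCohomology F F (Torus m) k ≃ₗ[F] singularCohomology F F (ComplexPoints A.X) k :=
    (singularCohomology.mapIso F F h.symm k).toLinearEquiv
  refine ⟨(torusMonomialBasisInt' m k).map eZ, (torusMonomialBasis F m k).map eF, fun s ↦ ?_⟩
  rw [Module.Basis.map_apply, Module.Basis.map_apply, torusMonomialBasisInt'_apply,
    torusMonomialBasis_apply]
  change singularCohomology.ringChange (Int.castRingHom F) (ComplexPoints A.X) k
      (singularCohomology.map ℤ ℤ (h.symm : C(ComplexPoints A.X, Torus m)) k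
        (torusMonomial ℤ m k (subsetEmb s))) =
    singularCohomology.map F F (h.symm : C(ComplexPoints A.X, Torus m)) k
      (torusMonomial F m k (subsetEmb s))
  rw [singularCohomology.ringChange_map, ringChange_torusMonomial]

/-- **Coordinates**: in compatible bases, `ι x = Σ_s (x_s : F) • b_F s` where `x = Σ_s x_s b_ℤ s`
(`ι` the change of coefficients `ℤ → F`, which is `ℤ`-semilinear: `ringChange_smul`).
[cite: HatcherAT2002, §3.1 p. 198] -/
theorem ringChange_int_apply_eq_sum {k : ℕ}
    {bZ : Module.Basis (Set.powersetCard (Fin (2 * A.dim)) k) ℤ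
      (singularCohomology ℤ ℤ (ComplexPoints A.X) k)}
    {bF : Module.Basis (Set.powersetCard (Fin (2 * A.dim)) k) F
      (singularCohomology F F (ComplexPoints A.X) k)}
    (hb : ∀ s, singularCohomology.ringChange (Int.castRingHom F) (ComplexPoints A.X) k (bZ s) = bF s)
    (x : singularCohomology ℤ ℤ (ComplexPoints A.X) k) :
    singularCohomology.ringChange (Int.castRingHom F) (ComplexPoints A.X) k x =
      ∑ s, ((bZ.repr x s : ℤ) : F) • bF s := by
  conv_lhs => rw [← bZ.sum_repr x]
  rw [map_sum]
  refine Finset.sum_congr rfl fun s _ ↦ ?_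
  rw [ringChange_smul, hb s, eq_intCast]

/-- **`Hᵏ(A(ℂ); ℤ) → Hᵏ(A(ℂ); F)` is injective** for a field `F` of characteristic `0`
(`Hᵏ(A(ℂ); ℤ)` is torsion free and `Hᵏ(A(ℂ); F) = Hᵏ(A(ℂ); ℤ) ⊗ F`; Lange §1.1.3, Voisin I
§7.1.1): in compatible bases `ι x = Σ (x_s : F) b_F s = 0` forces every integer `x_s` to vanish.
[cite: Lange2023AbelianVarietiesComplex, §1.1.3 (PDF p. 23)] [cite: VoisinHodgeI2002, §7.1.1] -/
theorem ringChange_int_injective [CharZero F] (k : ℕ) :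
    Injective (singularCohomology.ringChange (Int.castRingHom F) (ComplexPoints A.X) k) := by
  obtain ⟨bZ, bF, hb⟩ := exists_basis_ringChange_int_eq A F k
  refine (injective_iff_map_eq_zero _).2 fun x hx ↦ ?_
  rw [ringChange_int_apply_eq_sum A F hb x] at hx
  have hcoord : ∀ s, ((bZ.repr x s : ℤ) : F) = 0 := fun s ↦ by
    simpa using (Fintype.linearIndependent_iff.1 bF.linearIndependent _ hx) s
  refine bZ.ext_elem fun s ↦ ?_
  rw [map_zero, Finsupp.zero_apply]
  exact_mod_cast hcoord s

/-- **The integral classes span `Hᵏ(A(ℂ); F)` over `F`** (the image of `Hᵏ(A(ℂ); ℤ)` contains an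
`F`-basis): `Hᵏ(A(ℂ); F) = Hᵏ(A(ℂ); ℤ) ⊗ F`. [cite: Lange2023AbelianVarietiesComplex, §1.1.3 (PDF p. 23)]
[cite: VoisinHodgeI2002, §7.1.1] -/
theorem span_range_ringChange_int_eq_top (k : ℕ) :
    Submodule.span F (Set.range
      (singularCohomology.ringChange (Int.castRingHom F) (ComplexPoints A.X) k)) = ⊤ := by
  obtain ⟨bZ, bF, hb⟩ := exists_basis_ringChange_int_eq A F k
  refine eq_top_iff.2 (bF.span_eq.ge.trans (Submodule.span_mono ?_))
  rintro _ ⟨s, rfl⟩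
  exact ⟨bZ s, hb s⟩

/-- **The lattice of integral classes `ι(Hᵏ(A(ℂ); ℤ)) ⊂ Hᵏ(A(ℂ); F)` is isomorphic to
`Hᵏ(A(ℂ); ℤ)`** (so free of rank `C(2g, k)`, `AbelianVariety.finrank_singularCohomology_int`), for
`char F = 0`. [cite: Lange2023AbelianVarietiesComplex, §1.1.3 (PDF p. 23)] -/
theorem nonempty_range_ringChange_int_addEquiv [CharZero F] (k : ℕ) :
    Nonempty ((singularCohomology.ringChange (Int.castRingHom F) (ComplexPoints A.X) k).range ≃+
      singularCohomology ℤ ℤ (ComplexPoints A.X) k) :=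
  ⟨(AddMonoidHom.ofInjective (ringChange_int_injective A F k)).symm⟩

/-! ### `F = ℂ`: integral classes in the sense of the Hodge-theory files -/

/-- **`Hᵏ(A(ℂ); ℂ)` has a `ℂ`-basis of integral classes** (indexed by the `k`-subsets of
`Fin 2g`; `IsIntegralClass` = represented by a `ℤ`-valued cocycle = in the image of
`Hᵏ(A(ℂ); ℤ)`, `isIntegralClass_iff_mem_range_ringChange`).
[cite: Lange2023AbelianVarietiesComplex, §1.1.3 (PDF p. 23)] [cite: VoisinHodgeI2002, §7.1.1] -/
theorem exists_basis_isIntegralClass (k : ℕ) :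
    ∃ b : Module.Basis (Set.powersetCard (Fin (2 * A.dim)) k) ℂ
        (singularCohomology ℂ ℂ (ComplexPoints A.X) k),
      ∀ s, IsIntegralClass (b s) := by
  obtain ⟨bZ, bC, hb⟩ := exists_basis_ringChange_int_eq A ℂ k
  exact ⟨bC, fun s ↦ (isIntegralClass_iff_mem_range_ringChange _).2 ⟨bZ s, hb s⟩⟩

/-- **The integral classes span `Hᵏ(A(ℂ); ℂ)` over `ℂ`.**
[cite: Lange2023AbelianVarietiesComplex, §1.1.3 (PDF p. 23)] [cite: VoisinHodgeI2002, §7.1.1] -/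
theorem span_setOf_isIntegralClass_eq_top (k : ℕ) :
    Submodule.span ℂ {c : singularCohomology ℂ ℂ (ComplexPoints A.X) k | IsIntegralClass c} = ⊤ := by
  have h : {c : singularCohomology ℂ ℂ (ComplexPoints A.X) k | IsIntegralClass c} =
      Set.range (singularCohomology.ringChange (Int.castRingHom ℂ) (ComplexPoints A.X) k) :=
    Set.ext fun c ↦ isIntegralClass_iff_mem_range_ringChange c
  rw [h]
  exact span_range_ringChange_int_eq_top A ℂ k

/-- **Integral classes have integer coordinates**: in a pair of compatible bases, a class
`c ∈ Hᵏ(A(ℂ); ℂ)` is integral iff all its coordinates in `b_ℂ` are integers — the integral classes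
are exactly the `ℤ`-lattice spanned by the basis `b_ℂ`. [cite: VoisinHodgeI2002, §7.1.1]
[cite: Lange2023AbelianVarietiesComplex, §1.1.3 (PDF p. 23)] -/
theorem isIntegralClass_iff_forall_repr_mem_range {k : ℕ}
    {bZ : Module.Basis (Set.powersetCard (Fin (2 * A.dim)) k) ℤ
      (singularCohomology ℤ ℤ (ComplexPoints A.X) k)}
    {bC : Module.Basis (Set.powersetCard (Fin (2 * A.dim)) k) ℂ
      (singularCohomology ℂ ℂ (ComplexPoints A.X) k)}
    (hb : ∀ s, singularCohomology.ringChange (Int.castRingHom ℂ) (ComplexPoints A.X) k (bZ s) = bC s)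
    (c : singularCohomology ℂ ℂ (ComplexPoints A.X) k) :
    IsIntegralClass c ↔ ∀ s, bC.repr c s ∈ Set.range (Int.cast : ℤ → ℂ) := by
  rw [isIntegralClass_iff_mem_range_ringChange]
  constructor
  · rintro ⟨x, rfl⟩ s
    refine ⟨bZ.repr x s, ?_⟩
    rw [ringChange_int_apply_eq_sum A ℂ hb x, map_sum]
    simp only [map_smul, Module.Basis.repr_self, Finsupp.smul_single, smul_eq_mul, mul_one,
      Finsupp.finsetSum_apply, Finsupp.single_apply]
    rw [Finset.sum_eq_single s (fun t _ hts ↦ if_neg hts) (fun h ↦ (h (Finset.mem_univ s)).elim),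
      if_pos rfl]
  · intro h
    choose n hn using h
    refine ⟨∑ s, n s • bZ s, ?_⟩
    rw [map_sum]
    conv_rhs => rw [← bC.sum_repr c]
    refine Finset.sum_congr rfl fun s _ ↦ ?_
    rw [map_zsmul, hb s, ← hn s, Int.cast_smul_eq_zsmul]

end AbelianVariety

end Literature.AlgebraicGeometry.HodgeTheory

end
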